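import Summits.QuantumFields.YangMills.Theorems.UnitScaleTiltProp7CornerCombCovGradStep
import Summits.QuantumFields.YangMills.Theorems.UnitScaleTiltProp7CornerCombFamiliesPeriodic
import Summits.QuantumFields.YangMills.Theorems.UnitScaleTiltProp7CombWalkMassTwoBlock
import HarnessLib

/-!
# Route `UnitScaleTilt`, crux K1 «MinimiserStabilityRegPr» (stmt-QuantumFields-19200), route-R E′ (A′)-on-Σ, P-A2 (β), row «(n3)-comb» —
# (O2) GROUNDWORK, file F-8b-2: THE THREE LINES OF THE SPLIT COMB TOWER, INHABITED OVER A PERIOD CELL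

«(O2) groundwork — not consumed by any displayed row before the freeze lifts» (★★OWNER `ym3-torus-plan` g29∕g30 RULINGS №20 (2), №22 (c) «(II) GO»).
Cell `ym3-torus`, width seat `ym-ust-19200-w5` (gen 8); pen F-8b «THE CELL THEOREM» (★routeR-w1 g9 PENS ROUND 5, 2026-08-29 10:02Z), file 2.  THEOREMS ONLY (0 `def`,
0 `sorry`); `--supports stmt-QuantumFields-19200 --as helper`, count-neutral.  YM₃ on T³ is a ladder rung (R3), not the Clay problem; nothing here claims `hMcomb`, (β),
`hPA2`, the stub, the crux, d = 4 or the mass gap.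

THE POINT.  With the split `G̃ = G^{lin} + N` of ✓F-8b-1 `sourced_recursion_of_split` (sourceless reduced family `G^{lin}` from `Y₀`, sourced remainder `N` from `0`, source
`rem_j = Ỹ_{j+1} − T_j(Ỹ_j)` of ✓F-7a `tildTower_affine`), the scalar lines of ✓F-7c-1∕2∕3 are INHABITED by the period-cell `ℓ²` letters of one averaging step `j → j+1`
(coarse period `N′`, fine period `N′L`, background `Ūʲ = avgIter L U₀ j`, coarse bond `Ūʲ⁺¹(z,κ)` by lit ✓`avgIter_succ`):
* §1 `tsum_zero`, `trueStep_zero` (the zero tower inhabits the two-block source lemma's `hQs`);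
* §2 ★ `sqrt_mass_lin_step_le` — the SOURCELESS mass row `m_{j+1} ≤ (ρ + 210(2d+2)L·α_j·√(2d))·m_j`, `ρ = √(L²L⁻ᵈ)`: ★routeR-w4's F-7b-1 `sqrt_sum_cell_normSq_step_le_level` at
  source `0`; ★ `sqrt_mass_sourced_step_le` — the SOURCED row `n_{j+1} ≤ (ρ + …)·n_j + 260μ_j(2d+2)L√(2d)·ỹ_j`: F-7b-1 with the source priced by ✓H-3a
  `Prop7CombWalkMassTwoBlock.norm_rem2_succ_sub_trueStep_le_twoBlock` (`C = 260`, two-block sup window `72·μ ≤ 1`);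
* §3 ★ `sqrt_grad_lin_step_le` — the SOURCELESS gradient row `g_{j+1} ≤ √(L⁴L⁻ᵈ)·g_j + K_j·m_j`: ★routeR-w4's F-7b-2 `sqrt_sum_cell_normSq_covGrad_step_le` at `V = Ūʲ`, the
  coarse transports read as `Ūʲ⁺¹`;
* §4 the level dictionary of the FULL field: `sqrt_mass_full_le` (`ỹ_j ≤ m_j + n_j + λ_j` from ✓F-7a's structure identity, Minkowski), `sum_cell_normSq_add_le`
  (`MASS(X + X′) ≤ 2MASS(X) + 2MASS(X′)`), ★ `sum_cell_covGrad_le_of_periodic` (`GRAD(X′) ≤ 4d·MASS(X′)` for a periodic `X′` at a `U1` background, crude) and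
  `sum_cell_covGrad_add_le` (`GRAD(G^{lin} + N) ≤ 2·GRAD(G^{lin}) + 8d·MASS(N)` — the letters `wN = 4d·wG` of ✓F-7c-3 `lam_closure`).
HONEST SCOPE.  Instantiation + Minkowski; every window (`α_j ≤ 1∕24`, plaquettes `a_j`, `72μ_j ≤ 1`, unitarity of `Ūʲ`, `Ũʲ ∈ U1`) is a hypothesis (F-8c-3); `𝔸` any C⋆-algebra.

References: T. Bałaban, CMP **98** (1985) 17–51 [Balaban1985Averaging] ((2) p.17, (42)–(43) pp.23–24, (68)–(69) p.29, Prop. 3 (122)–(126) p.36); CMP **95** (1984) 17–40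
[Balaban1984PropagatorsI] ((1.18)–(1.20) pp.19–20); CMP **109** (1987) 249–301 [Balaban1987RG1] ((0.1), (0.4) pp.251–253).
-/

set_option autoImplicit false

noncomputable section

open scoped BigOperators
open Finset

namespace Summit.QuantumFields.YangMills.Theorems.Prop7CornerCombLinesInhabited

open NormedSpace
open Literature.MathematicalPhysics.QuantumFieldTheory.Balaban1983to89
open ExpMeanLog (eml)
open B7Prop1Explicit renaming Site → LSite
open B7Prop1Explicit (Letter e hol seg boxVec gammaWord plaqWord Wcx Xavg bavg expUnit U1)
open B7Prop2Explicit (avgIter avgIter_succ rescale_apply unitaryUnits unitaryUnits_le_U1)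
open B7Eq92Concrete (tildIter)
open B7Eq78Linearization (conjR conjR_apply)
open B7Prop3GeneralRotated (tsum norm_conjR_le)
open B7Prop3GeneralLinear (FhatCov)
open B7Prop3GeneralTild (tsum_add)
open T4TermwiseTorus (IsPeriodic)
open Summit.QuantumFields.YangMills.Theorems.Prop7CornerCombCovMassStep (sqrt_sum_cell_normSq_step_le_level sqrt_sum_normSq_le_of_le_add₃)
open Summit.QuantumFields.YangMills.Theorems.Prop7CornerCombCovGradStep (sqrt_sum_cell_normSq_covGrad_step_le)
open Summit.QuantumFields.YangMills.Theorems.Prop7CombWalkMassTwoBlock (norm_rem2_succ_sub_trueStep_le_twoBlock)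
open Summit.QuantumFields.YangMills.Theorems.Prop7CellBoxMultiplicity (sum_cell_shift_vec)
open Summit.QuantumFields.YangMills.Theorems.Prop7CornerCombFamiliesPeriodic (apply_add_period_of_isPeriodic)

variable {d : ℕ} {𝔸 : Type*} [CStarAlgebra 𝔸]

/-! ## §1 The zero tower -/

omit [CStarAlgebra 𝔸] in
/-- The transported sum of the zero field vanishes. [cite: Balaban1985Averaging, (58)–(61) p.28] -/
theorem tsum_zero [NormedRing 𝔸] [NormedAlgebra ℂ 𝔸] [CompleteSpace 𝔸] (V : LSite d → Fin d → 𝔸ˣ) (x : LSite d) (w : List (Letter d)) :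
    tsum V (0 : LSite d → Fin d → 𝔸) x w = 0 := by
  have h := tsum_add V (0 : LSite d → Fin d → 𝔸) 0 x w
  rw [add_zero] at h
  calc tsum V (0 : LSite d → Fin d → 𝔸) x w = (tsum V (0 : LSite d → Fin d → 𝔸) x w + tsum V (0 : LSite d → Fin d → 𝔸) x w)
      - tsum V (0 : LSite d → Fin d → 𝔸) x w := by rw [add_sub_cancel_right]
    _ = 0 := by rw [← h, sub_self]

variable [Nontrivial 𝔸]

omit [Nontrivial 𝔸] in
/-- The written-out true step of the zero field vanishes (so the zero tower `Q ≡ 0` inhabits ✓H-3a's `hQs`). [cite: Balaban1985Averaging, (119)–(122) pp.35–36] -/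
theorem trueStep_zero (L : ℕ) (V : LSite d → Fin d → 𝔸ˣ) (q : LSite d) (κ : Fin d) :
    fderiv ℂ (eml : ((Fin d → Fin L) → 𝔸) → 𝔸) (fun r => ((Wcx L V q κ (boxVec L r) : 𝔸ˣ) : 𝔸))
          (fun r => tsum V (0 : LSite d → Fin d → 𝔸) q (gammaWord L κ (boxVec L r) ++ seg κ (-(L : ℤ))) * ((Wcx L V q κ (boxVec L r) : 𝔸ˣ) : 𝔸))
          * (((expUnit (Xavg L V q κ))⁻¹ : 𝔸ˣ) : 𝔸)
        + ((expUnit (Xavg L V q κ) : 𝔸ˣ) : 𝔸) * tsum V (0 : LSite d → Fin d → 𝔸) q (seg κ (L : ℤ)) * (((expUnit (Xavg L V q κ))⁻¹ : 𝔸ˣ) : 𝔸) = 0 := by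
  have h0 : (fun r : Fin d → Fin L => tsum V (0 : LSite d → Fin d → 𝔸) q (gammaWord L κ (boxVec L r) ++ seg κ (-(L : ℤ))) * ((Wcx L V q κ (boxVec L r) : 𝔸ˣ) : 𝔸))
      = 0 := by
    funext r; rw [tsum_zero, zero_mul]; rfl
  rw [h0, map_zero, tsum_zero]
  simp

/-! ## §2 ★ The two mass rows -/

/-- ★ **THE SOURCELESS MASS ROW** `m_{j+1} ≤ (√(L²L⁻ᵈ) + 210(2d+2)L·α·√(2d))·m_j` over a period cell (coarse period `N′`, fine `N′L`): for the sourceless reduced step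
`X_{j+1}(z,κ) = T_j(X_j)(L•z,κ) − (F̂X_j(L•z) − Ad_{Ūʲ⁺¹(z,κ)}F̂X_j(L•(z + e κ)))` (✓F-7a∕F-8b-1 letters) of an `N′L`-periodic `X_j` at the unitary background `Ūʲ` with block loops
`≤ α ≤ 1∕24` — ★routeR-w4's F-7b-1 `sqrt_sum_cell_normSq_step_le_level` at source `R = 0`, driving field `0`. [cite: Balaban1985Averaging, Prop. 3 (122)–(126) p.36, (2) p.17] -/
theorem sqrt_mass_lin_step_le (L N' : ℕ) (hL : 1 ≤ L) [NeZero N'] (U₀ : LSite d → Fin d → 𝔸ˣ) (j : ℕ)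
    (hV : ∀ x μ, avgIter L U₀ j x μ ∈ unitaryUnits 𝔸) (Xj Xj1 : LSite d → Fin d → 𝔸)
    (hX : ∀ (x : LSite d) (κ μ : Fin d), Xj (x + ((N' * L : ℕ) : ℤ) • e κ) μ = Xj x μ)
    {α : ℝ} (hα0 : 0 ≤ α) (hα24 : α ≤ 1 / 24)
    (hα : ∀ (z : Fin d → Fin N') (κ : Fin d) (r : Fin d → Fin L), ‖((Wcx L (avgIter L U₀ j) ((L : ℤ) • boxVec N' z) κ (boxVec L r) : 𝔸ˣ) : 𝔸) - 1‖ ≤ α)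
    (hXs : ∀ (z : LSite d) (κ : Fin d), Xj1 z κ
      = (fderiv ℂ (eml : ((Fin d → Fin L) → 𝔸) → 𝔸) (fun r => ((Wcx L (avgIter L U₀ j) ((L : ℤ) • z) κ (boxVec L r) : 𝔸ˣ) : 𝔸))
            (fun r => tsum (avgIter L U₀ j) Xj ((L : ℤ) • z) (gammaWord L κ (boxVec L r) ++ seg κ (-(L : ℤ)))
              * ((Wcx L (avgIter L U₀ j) ((L : ℤ) • z) κ (boxVec L r) : 𝔸ˣ) : 𝔸))
            * (((expUnit (Xavg L (avgIter L U₀ j) ((L : ℤ) • z) κ))⁻¹ : 𝔸ˣ) : 𝔸)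
          + ((expUnit (Xavg L (avgIter L U₀ j) ((L : ℤ) • z) κ) : 𝔸ˣ) : 𝔸) * tsum (avgIter L U₀ j) Xj ((L : ℤ) • z) (seg κ (L : ℤ))
            * (((expUnit (Xavg L (avgIter L U₀ j) ((L : ℤ) • z) κ))⁻¹ : 𝔸ˣ) : 𝔸))
        - (FhatCov L (avgIter L U₀ j) Xj ((L : ℤ) • z) - conjR (avgIter L U₀ (j + 1) z κ) (FhatCov L (avgIter L U₀ j) Xj ((L : ℤ) • (z + e κ))))) :
    Real.sqrt (∑ z : Fin d → Fin N', ∑ κ : Fin d, ‖Xj1 (boxVec N' z) κ‖ ^ 2)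
      ≤ (Real.sqrt ((L : ℝ) ^ 2 * ((L : ℝ) ^ d)⁻¹) + 210 * ((2 * d + 2) * L) * α * Real.sqrt (2 * d))
          * Real.sqrt (∑ t' : Fin d → Fin (N' * L), ∑ ν : Fin d, ‖Xj (boxVec (N' * L) t') ν‖ ^ 2) := by
  have h := sqrt_sum_cell_normSq_step_le_level L N' hL U₀ j hV Xj Xj1 (fun _ _ => 0) (fun _ _ => 0) hX (fun _ _ _ => rfl) hα0 hα24 hα
    (C := 0) (μ := 0) le_rfl le_rfl (fun z κ => by rw [norm_zero, zero_mul]) (fun z κ => by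
      have : (∑ s : Fin d → Fin L, ∑ ν : Fin d, (‖(0 : 𝔸)‖ ^ 2 + ‖(0 : 𝔸)‖ ^ 2)) = 0 := by simp
      rw [this, Real.sqrt_zero, mul_zero])
    (fun z κ => by rw [hXs, smul_add, add_zero])
  simpa using h

/-- ★ **THE SOURCED MASS ROW** `n_{j+1} ≤ (√(L²L⁻ᵈ) + 210(2d+2)L·α·√(2d))·n_j + 260·μ·(2d+2)L·√(2d)·ỹ_j`: for the sourced reduced step of `N` (source `rem_j(z,κ) = Ỹ_{j+1}(z,κ) −
T_j(Ỹ_j)(L•z,κ)`, `Ỹ_i = Ũⁱ − 1`), ★routeR-w4's F-7b-1 with the source priced by ✓H-3a `norm_rem2_succ_sub_trueStep_le_twoBlock` (zero tower, `C = 260`) under the two-block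
sup window `(2d+2)L·√M₂(Ỹ_j) ≤ μ`, `72μ ≤ 1` at the cell's coarse bonds. [cite: Balaban1985Averaging, Prop. 3 (122)–(126) p.36, (68)–(69) p.29; Balaban1987RG1, (0.4) p.253] -/
theorem sqrt_mass_sourced_step_le (L N' : ℕ) (hL : 1 ≤ L) [NeZero N'] (U₀ U₁ : LSite d → Fin d → 𝔸ˣ) (j : ℕ)
    (hV : ∀ x μ, avgIter L U₀ j x μ ∈ unitaryUnits 𝔸) (hT : ∀ x μ, tildIter L U₀ U₁ j x μ ∈ U1 𝔸)
    (Yt : ℕ → LSite d → Fin d → 𝔸) (hYt : ∀ (i : ℕ) (x : LSite d) (μ : Fin d), Yt i x μ = ((tildIter L U₀ U₁ i x μ : 𝔸ˣ) : 𝔸) - 1)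
    (Nj Nj1 : LSite d → Fin d → 𝔸)
    (hX : ∀ (x : LSite d) (κ μ : Fin d), Nj (x + ((N' * L : ℕ) : ℤ) • e κ) μ = Nj x μ)
    (hY : ∀ (x : LSite d) (κ μ : Fin d), Yt j (x + ((N' * L : ℕ) : ℤ) • e κ) μ = Yt j x μ)
    {α : ℝ} (hα0 : 0 ≤ α) (hα24 : α ≤ 1 / 24)
    (hα : ∀ (z : Fin d → Fin N') (κ : Fin d) (r : Fin d → Fin L), ‖((Wcx L (avgIter L U₀ j) ((L : ℤ) • boxVec N' z) κ (boxVec L r) : 𝔸ˣ) : 𝔸) - 1‖ ≤ α)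
    {μ : ℝ} (hμ0 : 0 ≤ μ) (hμ72 : 72 * μ ≤ 1)
    (hμ : ∀ (z : Fin d → Fin N') (κ : Fin d), (2 * d + 2) * L * Real.sqrt (∑ s : Fin d → Fin L, ∑ ν : Fin d,
      (‖Yt j ((L : ℤ) • boxVec N' z + boxVec L s) ν‖ ^ 2 + ‖Yt j ((L : ℤ) • boxVec N' z + (L : ℤ) • e κ + boxVec L s) ν‖ ^ 2)) ≤ μ)
    (rem : LSite d → Fin d → 𝔸)
    (hrem : ∀ (z : LSite d) (κ : Fin d), rem z κ = Yt (j + 1) z κ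
      - (fderiv ℂ (eml : ((Fin d → Fin L) → 𝔸) → 𝔸) (fun r => ((Wcx L (avgIter L U₀ j) ((L : ℤ) • z) κ (boxVec L r) : 𝔸ˣ) : 𝔸))
            (fun r => tsum (avgIter L U₀ j) (Yt j) ((L : ℤ) • z) (gammaWord L κ (boxVec L r) ++ seg κ (-(L : ℤ)))
              * ((Wcx L (avgIter L U₀ j) ((L : ℤ) • z) κ (boxVec L r) : 𝔸ˣ) : 𝔸))
            * (((expUnit (Xavg L (avgIter L U₀ j) ((L : ℤ) • z) κ))⁻¹ : 𝔸ˣ) : 𝔸)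
          + ((expUnit (Xavg L (avgIter L U₀ j) ((L : ℤ) • z) κ) : 𝔸ˣ) : 𝔸) * tsum (avgIter L U₀ j) (Yt j) ((L : ℤ) • z) (seg κ (L : ℤ))
            * (((expUnit (Xavg L (avgIter L U₀ j) ((L : ℤ) • z) κ))⁻¹ : 𝔸ˣ) : 𝔸)))
    (hNs : ∀ (z : LSite d) (κ : Fin d), Nj1 z κ
      = (fderiv ℂ (eml : ((Fin d → Fin L) → 𝔸) → 𝔸) (fun r => ((Wcx L (avgIter L U₀ j) ((L : ℤ) • z) κ (boxVec L r) : 𝔸ˣ) : 𝔸))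
            (fun r => tsum (avgIter L U₀ j) Nj ((L : ℤ) • z) (gammaWord L κ (boxVec L r) ++ seg κ (-(L : ℤ)))
              * ((Wcx L (avgIter L U₀ j) ((L : ℤ) • z) κ (boxVec L r) : 𝔸ˣ) : 𝔸))
            * (((expUnit (Xavg L (avgIter L U₀ j) ((L : ℤ) • z) κ))⁻¹ : 𝔸ˣ) : 𝔸)
          + ((expUnit (Xavg L (avgIter L U₀ j) ((L : ℤ) • z) κ) : 𝔸ˣ) : 𝔸) * tsum (avgIter L U₀ j) Nj ((L : ℤ) • z) (seg κ (L : ℤ))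
            * (((expUnit (Xavg L (avgIter L U₀ j) ((L : ℤ) • z) κ))⁻¹ : 𝔸ˣ) : 𝔸))
        - (FhatCov L (avgIter L U₀ j) Nj ((L : ℤ) • z) - conjR (avgIter L U₀ (j + 1) z κ) (FhatCov L (avgIter L U₀ j) Nj ((L : ℤ) • (z + e κ))))
        + rem z κ) :
    Real.sqrt (∑ z : Fin d → Fin N', ∑ κ : Fin d, ‖Nj1 (boxVec N' z) κ‖ ^ 2)
      ≤ (Real.sqrt ((L : ℝ) ^ 2 * ((L : ℝ) ^ d)⁻¹) + 210 * ((2 * d + 2) * L) * α * Real.sqrt (2 * d))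
          * Real.sqrt (∑ t' : Fin d → Fin (N' * L), ∑ ν : Fin d, ‖Nj (boxVec (N' * L) t') ν‖ ^ 2)
        + 260 * μ * ((2 * d + 2) * L) * Real.sqrt (2 * d)
          * Real.sqrt (∑ t' : Fin d → Fin (N' * L), ∑ ν : Fin d, ‖Yt j (boxVec (N' * L) t') ν‖ ^ 2) := by
  -- the source priced by the two-block walk masses (zero tower in ✓H-3a's letters)
  have hR : ∀ (z : Fin d → Fin N') (κ : Fin d), ‖rem (boxVec N' z) κ‖ ≤ 260 * (((2 * d + 2) * L) ^ 2 * ∑ s : Fin d → Fin L, ∑ ν : Fin d,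
      (‖Yt j ((L : ℤ) • boxVec N' z + boxVec L s) ν‖ ^ 2 + ‖Yt j ((L : ℤ) • boxVec N' z + (L : ℤ) • e κ + boxVec L s) ν‖ ^ 2)) := by
    intro z κ
    have hm72 : 72 * ((2 * d + 2) * L * Real.sqrt (∑ s : Fin d → Fin L, ∑ ν : Fin d,
        (‖Yt j ((L : ℤ) • boxVec N' z + boxVec L s) ν‖ ^ 2 + ‖Yt j ((L : ℤ) • boxVec N' z + (L : ℤ) • e κ + boxVec L s) ν‖ ^ 2))) ≤ 1 :=
      (mul_le_mul_of_nonneg_left (hμ z κ) (by norm_num)).trans hμ72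
    have h := norm_rem2_succ_sub_trueStep_le_twoBlock L hL U₀ U₁ j hV hT (Yt j) (hYt j) (fun _ _ => 0) 0
      (fun z' κ' => by rw [Pi.zero_apply, Pi.zero_apply, trueStep_zero]) (boxVec N' z) κ hm72 (hα z κ) hα24
    simp only [sub_zero, Pi.zero_apply] at h
    rw [hrem, hYt (j + 1)]
    exact h
  exact sqrt_sum_cell_normSq_step_le_level L N' hL U₀ j hV Nj Nj1 rem (Yt j) hX hY hα0 hα24 hα (C := 260) (by norm_num) hμ0 hR hμ
    (fun z κ => by rw [hNs, smul_add])

/-! ## §3 ★ The sourceless gradient row at level `j` -/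

/-- ★ **THE SOURCELESS GRADIENT ROW AT LEVEL `j`** `g_{j+1} ≤ √(L⁴L⁻ᵈ)·g_j + ((24α + 8((d+2)L)²a)·√(d·L²L⁻ᵈ) + 210(2d+2)L·α·√(8d²))·m_j`: ★routeR-w4's F-7b-2
`sqrt_sum_cell_normSq_covGrad_step_le` at `V = Ūʲ`, the coarse transports `\overline{Ūʲ}(L•z,ν)` read as `Ūʲ⁺¹(z,ν)` (lit ✓`avgIter_succ`); for the sourceless reduced step of an
`N′L`-periodic `X_j` at the unitary, `N′L`-periodic background `Ūʲ` (plaquettes `≤ a`, block loops `≤ α ≤ 1∕24`). [cite: Balaban1985Averaging, (42)–(47) pp.23–25, Prop. 3 (122)–(126) p.36] -/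
theorem sqrt_grad_lin_step_le (L N' : ℕ) (hL : 1 ≤ L) [NeZero N'] (U₀ : LSite d → Fin d → 𝔸ˣ) (j : ℕ)
    (hV : ∀ x μ, avgIter L U₀ j x μ ∈ unitaryUnits 𝔸)
    (hVper : ∀ (x : LSite d) (κ μ : Fin d), avgIter L U₀ j (x + ((N' * L : ℕ) : ℤ) • e κ) μ = avgIter L U₀ j x μ)
    {a : ℝ} (ha : 0 ≤ a) (hplaq : ∀ (x : LSite d) (κ' μ : Fin d), κ' ≠ μ → ‖((hol (avgIter L U₀ j) x (plaqWord κ' μ) : 𝔸ˣ) : 𝔸) - 1‖ ≤ a)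
    {α : ℝ} (hα0 : 0 ≤ α) (hα24 : α ≤ 1 / 24)
    (hα : ∀ (z : LSite d) (κ : Fin d) (r : Fin d → Fin L), ‖((Wcx L (avgIter L U₀ j) ((L : ℤ) • z) κ (boxVec L r) : 𝔸ˣ) : 𝔸) - 1‖ ≤ α)
    (Xj Xj1 : LSite d → Fin d → 𝔸) (hX : ∀ (x : LSite d) (κ μ : Fin d), Xj (x + ((N' * L : ℕ) : ℤ) • e κ) μ = Xj x μ)
    (hXs : ∀ (z : LSite d) (κ : Fin d), Xj1 z κ
      = (fderiv ℂ (eml : ((Fin d → Fin L) → 𝔸) → 𝔸) (fun r => ((Wcx L (avgIter L U₀ j) ((L : ℤ) • z) κ (boxVec L r) : 𝔸ˣ) : 𝔸))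
            (fun r => tsum (avgIter L U₀ j) Xj ((L : ℤ) • z) (gammaWord L κ (boxVec L r) ++ seg κ (-(L : ℤ)))
              * ((Wcx L (avgIter L U₀ j) ((L : ℤ) • z) κ (boxVec L r) : 𝔸ˣ) : 𝔸))
            * (((expUnit (Xavg L (avgIter L U₀ j) ((L : ℤ) • z) κ))⁻¹ : 𝔸ˣ) : 𝔸)
          + ((expUnit (Xavg L (avgIter L U₀ j) ((L : ℤ) • z) κ) : 𝔸ˣ) : 𝔸) * tsum (avgIter L U₀ j) Xj ((L : ℤ) • z) (seg κ (L : ℤ))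
            * (((expUnit (Xavg L (avgIter L U₀ j) ((L : ℤ) • z) κ))⁻¹ : 𝔸ˣ) : 𝔸))
        - (FhatCov L (avgIter L U₀ j) Xj ((L : ℤ) • z) - conjR (avgIter L U₀ (j + 1) z κ) (FhatCov L (avgIter L U₀ j) Xj ((L : ℤ) • (z + e κ))))) :
    Real.sqrt (∑ z : Fin d → Fin N', ∑ κ : Fin d, ∑ ν : Fin d,
        ‖conjR (avgIter L U₀ (j + 1) (boxVec N' z) ν) (Xj1 (boxVec N' z + e ν) κ) - Xj1 (boxVec N' z) κ‖ ^ 2)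
      ≤ Real.sqrt ((L : ℝ) ^ 4 * ((L : ℝ) ^ d)⁻¹)
          * Real.sqrt (∑ t' : Fin d → Fin (N' * L), ∑ κ : Fin d, ∑ ν : Fin d,
              ‖conjR (avgIter L U₀ j (boxVec (N' * L) t') ν) (Xj (boxVec (N' * L) t' + e ν) κ) - Xj (boxVec (N' * L) t') κ‖ ^ 2)
        + ((24 * α + 8 * (((d : ℝ) + 2) * L) ^ 2 * a) * Real.sqrt (d * ((L : ℝ) ^ 2 * ((L : ℝ) ^ d)⁻¹))
            + 210 * ((2 * d + 2) * L) * α * Real.sqrt (8 * (d : ℝ) ^ 2))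
          * Real.sqrt (∑ t' : Fin d → Fin (N' * L), ∑ ν : Fin d, ‖Xj (boxVec (N' * L) t') ν‖ ^ 2) := by
  have hXs' : ∀ (z : LSite d) (κ : Fin d), Xj1 z κ
      = fderiv ℂ (eml : ((Fin d → Fin L) → 𝔸) → 𝔸) (fun r => ((Wcx L (avgIter L U₀ j) ((L : ℤ) • z) κ (boxVec L r) : 𝔸ˣ) : 𝔸))
            (fun r => tsum (avgIter L U₀ j) Xj ((L : ℤ) • z) (gammaWord L κ (boxVec L r) ++ seg κ (-(L : ℤ)))
              * ((Wcx L (avgIter L U₀ j) ((L : ℤ) • z) κ (boxVec L r) : 𝔸ˣ) : 𝔸))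
            * (((expUnit (Xavg L (avgIter L U₀ j) ((L : ℤ) • z) κ))⁻¹ : 𝔸ˣ) : 𝔸)
          + ((expUnit (Xavg L (avgIter L U₀ j) ((L : ℤ) • z) κ) : 𝔸ˣ) : 𝔸) * tsum (avgIter L U₀ j) Xj ((L : ℤ) • z) (seg κ (L : ℤ))
            * (((expUnit (Xavg L (avgIter L U₀ j) ((L : ℤ) • z) κ))⁻¹ : 𝔸ˣ) : 𝔸)
        - (FhatCov L (avgIter L U₀ j) Xj ((L : ℤ) • z)
            - conjR (bavg L (avgIter L U₀ j) ((L : ℤ) • z) κ) (FhatCov L (avgIter L U₀ j) Xj ((L : ℤ) • z + (L : ℤ) • e κ))) := by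
    intro z κ; rw [hXs, smul_add]; rfl
  have h := sqrt_sum_cell_normSq_covGrad_step_le L N' hL (avgIter L U₀ j) hV hVper ha hplaq hα0 hα24 hα Xj Xj1 hX hXs'
  exact h

/-! ## §4 The level dictionary of the full field -/

omit [Nontrivial 𝔸] in
/-- `MASS(X + X′) ≤ 2·MASS(X) + 2·MASS(X′)` over any index set. [folklore] -/
theorem sum_cell_normSq_add_le {ι : Type*} (s : Finset ι) {E : Type*} [SeminormedAddCommGroup E] (f g : ι → E) :
    ∑ i ∈ s, ‖f i + g i‖ ^ 2 ≤ 2 * ∑ i ∈ s, ‖f i‖ ^ 2 + 2 * ∑ i ∈ s, ‖g i‖ ^ 2 := by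
  rw [Finset.mul_sum, Finset.mul_sum, ← Finset.sum_add_distrib]
  refine Finset.sum_le_sum fun i _ => ?_
  have h := norm_add_le (f i) (g i)
  nlinarith [norm_nonneg (f i + g i), norm_nonneg (f i), norm_nonneg (g i), sq_nonneg (‖f i‖ - ‖g i‖)]

omit [Nontrivial 𝔸] in
/-- ★ **THE FULL FIELD'S MASS FROM THE THREE LETTERS**: from ✓F-7a's structure identity `Ỹ_j(z,κ) = G^{lin}_j(z,κ) + N_j(z,κ) + (Λ_j z − Ad_{Ūʲ(z,κ)}Λ_j(z + e κ))` on the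
cell, Minkowski: `ỹ_j ≤ m_j + n_j + λ_j`. [cite: Balaban1985Averaging, (68) p.29; Balaban1984PropagatorsI, (1.18)–(1.20)] -/
theorem sqrt_mass_full_le (M : ℕ) (V : LSite d → Fin d → 𝔸ˣ) (Y G Nn : LSite d → Fin d → 𝔸) (Λ : LSite d → 𝔸)
    (hY : ∀ (z : LSite d) (κ : Fin d), Y z κ = (G z κ + Nn z κ) + (Λ z - conjR (V z κ) (Λ (z + e κ)))) :
    Real.sqrt (∑ t : Fin d → Fin M, ∑ κ : Fin d, ‖Y (boxVec M t) κ‖ ^ 2)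
      ≤ Real.sqrt (∑ t : Fin d → Fin M, ∑ κ : Fin d, ‖G (boxVec M t) κ‖ ^ 2) + Real.sqrt (∑ t : Fin d → Fin M, ∑ κ : Fin d, ‖Nn (boxVec M t) κ‖ ^ 2)
        + Real.sqrt (∑ t : Fin d → Fin M, ∑ κ : Fin d, ‖Λ (boxVec M t) - conjR (V (boxVec M t) κ) (Λ (boxVec M t + e κ))‖ ^ 2) := by
  have h := sqrt_sum_normSq_le_of_le_add₃ (Finset.univ : Finset ((Fin d → Fin M) × Fin d)) (fun p => Y (boxVec M p.1) p.2)
    (fun p => ‖G (boxVec M p.1) p.2‖) (fun p => ‖Nn (boxVec M p.1) p.2‖) (fun p => ‖Λ (boxVec M p.1) - conjR (V (boxVec M p.1) p.2) (Λ (boxVec M p.1 + e p.2))‖)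
    (fun p _ => by rw [hY]; exact norm_add₃_le)
  simpa only [Fintype.sum_prod_type] using h

/-- ★ **THE COVARIANT GRADIENT ENERGY OF A PERIODIC FIELD, CRUDELY**: for `X′` `M`-periodic and `V` `U1`-valued, `Σ_{t,κ,ν}‖Ad_{V(t,ν)}X′(t + e ν, κ) − X′(t,κ)‖² ≤ 4d·Σ_{t,ν}‖X′(t,ν)‖²`
(`‖Ad_V a − b‖² ≤ 2‖a‖² + 2‖b‖²`, lit ✓`norm_conjR_le`; the shifted cell sums by ✓F-6d-1 `sum_cell_shift_vec`). [cite: Balaban1987RG1, (0.1) p.251; Balaban1985Averaging, (2) p.17] -/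
theorem sum_cell_covGrad_le_of_periodic (M : ℕ) [NeZero M] (V : LSite d → Fin d → 𝔸ˣ) (hV : ∀ x μ, V x μ ∈ U1 𝔸) (X : LSite d → Fin d → 𝔸)
    (hX : ∀ (x : LSite d) (κ μ : Fin d), X (x + ((M : ℕ) : ℤ) • e κ) μ = X x μ) :
    ∑ t : Fin d → Fin M, ∑ κ : Fin d, ∑ ν : Fin d, ‖conjR (V (boxVec M t) ν) (X (boxVec M t + e ν) κ) - X (boxVec M t) κ‖ ^ 2
      ≤ 4 * d * ∑ t : Fin d → Fin M, ∑ κ : Fin d, ‖X (boxVec M t) κ‖ ^ 2 := by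
  have hpt : ∀ (t : Fin d → Fin M) (κ ν : Fin d), ‖conjR (V (boxVec M t) ν) (X (boxVec M t + e ν) κ) - X (boxVec M t) κ‖ ^ 2
      ≤ 2 * ‖X (boxVec M t + e ν) κ‖ ^ 2 + 2 * ‖X (boxVec M t) κ‖ ^ 2 := by
    intro t κ ν
    have h1 := norm_sub_le (conjR (V (boxVec M t) ν) (X (boxVec M t + e ν) κ)) (X (boxVec M t) κ)
    have h2 := norm_conjR_le (hV (boxVec M t) ν) (X (boxVec M t + e ν) κ)
    nlinarith [norm_nonneg (conjR (V (boxVec M t) ν) (X (boxVec M t + e ν) κ) - X (boxVec M t) κ), norm_nonneg (X (boxVec M t + e ν) κ),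
      norm_nonneg (X (boxVec M t) κ), sq_nonneg (‖X (boxVec M t + e ν) κ‖ - ‖X (boxVec M t) κ‖)]
  have hshift : ∀ ν : Fin d, ∑ t : Fin d → Fin M, ∑ κ : Fin d, ‖X (boxVec M t + e ν) κ‖ ^ 2 = ∑ t : Fin d → Fin M, ∑ κ : Fin d, ‖X (boxVec M t) κ‖ ^ 2 :=
    fun ν => sum_cell_shift_vec M (fun x => ∑ κ : Fin d, ‖X x κ‖ ^ 2) (fun x ι => by simp_rw [hX x ι]) (e ν)
  set MASS : ℝ := ∑ t : Fin d → Fin M, ∑ κ : Fin d, ‖X (boxVec M t) κ‖ ^ 2 with hMASS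
  have hA : ∑ t : Fin d → Fin M, ∑ κ : Fin d, ∑ ν : Fin d, ‖X (boxVec M t + e ν) κ‖ ^ 2 = d * MASS := by
    calc ∑ t : Fin d → Fin M, ∑ κ : Fin d, ∑ ν : Fin d, ‖X (boxVec M t + e ν) κ‖ ^ 2
        = ∑ t : Fin d → Fin M, ∑ ν : Fin d, ∑ κ : Fin d, ‖X (boxVec M t + e ν) κ‖ ^ 2 := Finset.sum_congr rfl fun t _ => Finset.sum_comm
      _ = ∑ ν : Fin d, ∑ t : Fin d → Fin M, ∑ κ : Fin d, ‖X (boxVec M t + e ν) κ‖ ^ 2 := Finset.sum_comm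
      _ = ∑ ν : Fin d, MASS := Finset.sum_congr rfl fun ν _ => hshift ν
      _ = d * MASS := by rw [Finset.sum_const, Finset.card_univ, Fintype.card_fin, nsmul_eq_mul]
  have hB : ∑ t : Fin d → Fin M, ∑ κ : Fin d, ∑ ν : Fin d, ‖X (boxVec M t) κ‖ ^ 2 = d * MASS := by
    simp only [Finset.sum_const, Finset.card_univ, Fintype.card_fin, nsmul_eq_mul, hMASS, Finset.mul_sum]
  calc ∑ t : Fin d → Fin M, ∑ κ : Fin d, ∑ ν : Fin d, ‖conjR (V (boxVec M t) ν) (X (boxVec M t + e ν) κ) - X (boxVec M t) κ‖ ^ 2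
      ≤ ∑ t : Fin d → Fin M, ∑ κ : Fin d, ∑ ν : Fin d, (2 * ‖X (boxVec M t + e ν) κ‖ ^ 2 + 2 * ‖X (boxVec M t) κ‖ ^ 2) :=
        Finset.sum_le_sum fun t _ => Finset.sum_le_sum fun κ _ => Finset.sum_le_sum fun ν _ => hpt t κ ν
    _ = 2 * ∑ t : Fin d → Fin M, ∑ κ : Fin d, ∑ ν : Fin d, ‖X (boxVec M t + e ν) κ‖ ^ 2
        + 2 * ∑ t : Fin d → Fin M, ∑ κ : Fin d, ∑ ν : Fin d, ‖X (boxVec M t) κ‖ ^ 2 := by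
          simp only [Finset.sum_add_distrib, Finset.mul_sum]
    _ = 4 * d * MASS := by rw [hA, hB]; ring

/-- **THE GRADIENT OF THE SPLIT**: `GRAD(G^{lin} + N) ≤ 2·GRAD(G^{lin}) + 8d·MASS(N)` (`N` `M`-periodic, `V` `U1`-valued) — the letters `wN = 4d·wG` of ✓F-7c-3 `lam_closure`.
[cite: Balaban1987RG1, (0.1), (0.4) pp.251–253] -/
theorem sum_cell_covGrad_add_le (M : ℕ) [NeZero M] (V : LSite d → Fin d → 𝔸ˣ) (hV : ∀ x μ, V x μ ∈ U1 𝔸) (G Nn : LSite d → Fin d → 𝔸)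
    (hN : ∀ (x : LSite d) (κ μ : Fin d), Nn (x + ((M : ℕ) : ℤ) • e κ) μ = Nn x μ) :
    ∑ t : Fin d → Fin M, ∑ κ : Fin d, ∑ ν : Fin d, ‖conjR (V (boxVec M t) ν) ((G + Nn) (boxVec M t + e ν) κ) - (G + Nn) (boxVec M t) κ‖ ^ 2
      ≤ 2 * ∑ t : Fin d → Fin M, ∑ κ : Fin d, ∑ ν : Fin d, ‖conjR (V (boxVec M t) ν) (G (boxVec M t + e ν) κ) - G (boxVec M t) κ‖ ^ 2
        + 8 * d * ∑ t : Fin d → Fin M, ∑ κ : Fin d, ‖Nn (boxVec M t) κ‖ ^ 2 := by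
  have hsplit : ∀ (t : Fin d → Fin M) (κ ν : Fin d), conjR (V (boxVec M t) ν) ((G + Nn) (boxVec M t + e ν) κ) - (G + Nn) (boxVec M t) κ
      = (conjR (V (boxVec M t) ν) (G (boxVec M t + e ν) κ) - G (boxVec M t) κ) + (conjR (V (boxVec M t) ν) (Nn (boxVec M t + e ν) κ) - Nn (boxVec M t) κ) := by
    intro t κ ν
    simp only [Pi.add_apply, conjR_apply]
    noncomm_ring
  have h := sum_cell_normSq_add_le (Finset.univ : Finset ((Fin d → Fin M) × Fin d × Fin d))
    (fun p => conjR (V (boxVec M p.1) p.2.2) (G (boxVec M p.1 + e p.2.2) p.2.1) - G (boxVec M p.1) p.2.1)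
    (fun p => conjR (V (boxVec M p.1) p.2.2) (Nn (boxVec M p.1 + e p.2.2) p.2.1) - Nn (boxVec M p.1) p.2.1)
  simp only [Fintype.sum_prod_type] at h
  have hN4 := sum_cell_covGrad_le_of_periodic M V hV Nn hN
  calc ∑ t : Fin d → Fin M, ∑ κ : Fin d, ∑ ν : Fin d, ‖conjR (V (boxVec M t) ν) ((G + Nn) (boxVec M t + e ν) κ) - (G + Nn) (boxVec M t) κ‖ ^ 2
      = ∑ t : Fin d → Fin M, ∑ κ : Fin d, ∑ ν : Fin d, ‖(conjR (V (boxVec M t) ν) (G (boxVec M t + e ν) κ) - G (boxVec M t) κ)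
          + (conjR (V (boxVec M t) ν) (Nn (boxVec M t + e ν) κ) - Nn (boxVec M t) κ)‖ ^ 2 := by
        simp_rw [hsplit]
    _ ≤ _ := h
    _ ≤ _ := by nlinarith [hN4]

/-! ## §5 ★ The step-defect slot of the sourced reduced family (no corner: print's straight step IS the reduced step's main part) -/

open B7Prop1Explicit (treeWord) in
open B7Prop3GeneralLinear (Q0cov) in
open Summit.QuantumFields.YangMills.Theorems.Prop7CornerCombCovMassStep (sum_cell_normSq_source_le) in
open Summit.QuantumFields.YangMills.Theorems.Prop7CombTrueStepDefectCell (sum_cell_trueStep_defect_sq_le) in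
open Summit.QuantumFields.YangMills.Theorems.Prop7CornerCombCovGradTransfer (smul_Q0cov_eq_sum) in
/-- ★ **THE DEF SLOT OF ★routeR-w6's F-6d-3 FOR THE SOURCED REDUCED FAMILY**: for the sourced reduced step `X_{j+1} = T_j(X_j) − [F̂X_j(L•·) − Ad_{Ūʲ⁺¹}F̂X_j(L•(· + e))] + rem_j`
(✓F-7a∕F-8b-1 letters; `X_j = G̃_j` `N′L`-periodic), the deviation from print's STRAIGHT step — F-6d-3's literal `Σ_μ Σ_y ‖X_{j+1}(y,μ) − Σ_r Σ_{t<L} L⁻ᵈ•R(Ūʲ(treeWord r ++ seg μ t))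
X_j(L•y + r + t•e μ, μ)‖²` — is the F-5a defect plus the source: by ✓F-5a (`T − corner = L•Q₀ + DEF`, the corner INSIDE), cov-2 ✓`smul_Q0cov_eq_sum`, ✓F-5c `sum_cell_trueStep_defect_sq_le`
and ✓F-7b-1 §3 `sum_cell_normSq_source_le` (source priced by ✓H-3a, zero tower):
`≤ 2·(210(2d+2)L)²α²(2d)·MASS(X_j) + 2·(260μ)²((2d+2)L)²·2d·MASS(Ỹ_j)`. [cite: Balaban1985Averaging, Prop. 3 (122)–(126) p.36, (68)–(69) p.29] -/
theorem sum_cell_stepDefect_sq_le (L N' : ℕ) (hL : 1 ≤ L) [NeZero N'] (U₀ U₁ : LSite d → Fin d → 𝔸ˣ) (j : ℕ)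
    (hV : ∀ x μ, avgIter L U₀ j x μ ∈ unitaryUnits 𝔸) (hT : ∀ x μ, tildIter L U₀ U₁ j x μ ∈ U1 𝔸)
    (Yt : ℕ → LSite d → Fin d → 𝔸) (hYt : ∀ (i : ℕ) (x : LSite d) (μ : Fin d), Yt i x μ = ((tildIter L U₀ U₁ i x μ : 𝔸ˣ) : 𝔸) - 1)
    (Xj Xj1 : LSite d → Fin d → 𝔸)
    (hX : ∀ (x : LSite d) (κ μ : Fin d), Xj (x + ((N' * L : ℕ) : ℤ) • e κ) μ = Xj x μ)
    (hY : ∀ (x : LSite d) (κ μ : Fin d), Yt j (x + ((N' * L : ℕ) : ℤ) • e κ) μ = Yt j x μ)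
    {α : ℝ} (hα24 : α ≤ 1 / 24)
    (hα : ∀ (z : Fin d → Fin N') (κ : Fin d) (r : Fin d → Fin L), ‖((Wcx L (avgIter L U₀ j) ((L : ℤ) • boxVec N' z) κ (boxVec L r) : 𝔸ˣ) : 𝔸) - 1‖ ≤ α)
    {μ : ℝ} (hμ72 : 72 * μ ≤ 1)
    (hμ : ∀ (z : Fin d → Fin N') (κ : Fin d), (2 * d + 2) * L * Real.sqrt (∑ s : Fin d → Fin L, ∑ ν : Fin d,
      (‖Yt j ((L : ℤ) • boxVec N' z + boxVec L s) ν‖ ^ 2 + ‖Yt j ((L : ℤ) • boxVec N' z + (L : ℤ) • e κ + boxVec L s) ν‖ ^ 2)) ≤ μ)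
    (rem : LSite d → Fin d → 𝔸)
    (hrem : ∀ (z : LSite d) (κ : Fin d), rem z κ = Yt (j + 1) z κ
      - (fderiv ℂ (eml : ((Fin d → Fin L) → 𝔸) → 𝔸) (fun r => ((Wcx L (avgIter L U₀ j) ((L : ℤ) • z) κ (boxVec L r) : 𝔸ˣ) : 𝔸))
            (fun r => tsum (avgIter L U₀ j) (Yt j) ((L : ℤ) • z) (gammaWord L κ (boxVec L r) ++ seg κ (-(L : ℤ)))
              * ((Wcx L (avgIter L U₀ j) ((L : ℤ) • z) κ (boxVec L r) : 𝔸ˣ) : 𝔸))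
            * (((expUnit (Xavg L (avgIter L U₀ j) ((L : ℤ) • z) κ))⁻¹ : 𝔸ˣ) : 𝔸)
          + ((expUnit (Xavg L (avgIter L U₀ j) ((L : ℤ) • z) κ) : 𝔸ˣ) : 𝔸) * tsum (avgIter L U₀ j) (Yt j) ((L : ℤ) • z) (seg κ (L : ℤ))
            * (((expUnit (Xavg L (avgIter L U₀ j) ((L : ℤ) • z) κ))⁻¹ : 𝔸ˣ) : 𝔸)))
    (hXs : ∀ (z : LSite d) (κ : Fin d), Xj1 z κ
      = (fderiv ℂ (eml : ((Fin d → Fin L) → 𝔸) → 𝔸) (fun r => ((Wcx L (avgIter L U₀ j) ((L : ℤ) • z) κ (boxVec L r) : 𝔸ˣ) : 𝔸))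
            (fun r => tsum (avgIter L U₀ j) Xj ((L : ℤ) • z) (gammaWord L κ (boxVec L r) ++ seg κ (-(L : ℤ)))
              * ((Wcx L (avgIter L U₀ j) ((L : ℤ) • z) κ (boxVec L r) : 𝔸ˣ) : 𝔸))
            * (((expUnit (Xavg L (avgIter L U₀ j) ((L : ℤ) • z) κ))⁻¹ : 𝔸ˣ) : 𝔸)
          + ((expUnit (Xavg L (avgIter L U₀ j) ((L : ℤ) • z) κ) : 𝔸ˣ) : 𝔸) * tsum (avgIter L U₀ j) Xj ((L : ℤ) • z) (seg κ (L : ℤ))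
            * (((expUnit (Xavg L (avgIter L U₀ j) ((L : ℤ) • z) κ))⁻¹ : 𝔸ˣ) : 𝔸))
        - (FhatCov L (avgIter L U₀ j) Xj ((L : ℤ) • z) - conjR (avgIter L U₀ (j + 1) z κ) (FhatCov L (avgIter L U₀ j) Xj ((L : ℤ) • (z + e κ))))
        + rem z κ) :
    ∑ μ : Fin d, ∑ y : Fin d → Fin N', ‖Xj1 (boxVec N' y) μ
        - ∑ r : Fin d → Fin L, ∑ t ∈ Finset.range L, (((L : ℝ) ^ d)⁻¹) •
            conjR (hol (avgIter L U₀ j) ((L : ℤ) • boxVec N' y) (treeWord (boxVec L r) ++ seg μ (t : ℤ))) (Xj ((L : ℤ) • boxVec N' y + boxVec L r + (t : ℤ) • e μ) μ)‖ ^ 2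
      ≤ 2 * ((210 * ((2 * d + 2) * L)) ^ 2 * α ^ 2 * (2 * d) * ∑ t' : Fin d → Fin (N' * L), ∑ ν : Fin d, ‖Xj (boxVec (N' * L) t') ν‖ ^ 2)
        + 2 * ((260 * μ) ^ 2 * (((2 * d + 2) * L) ^ 2 * (2 * d * ∑ t' : Fin d → Fin (N' * L), ∑ ν : Fin d, ‖Yt j (boxVec (N' * L) t') ν‖ ^ 2))) := by
  -- the source priced by the two-block walk masses (as in `sqrt_mass_sourced_step_le`)
  have hR : ∀ (z : Fin d → Fin N') (κ : Fin d), ‖rem (boxVec N' z) κ‖ ≤ 260 * (((2 * d + 2) * L) ^ 2 * ∑ s : Fin d → Fin L, ∑ ν : Fin d,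
      (‖Yt j ((L : ℤ) • boxVec N' z + boxVec L s) ν‖ ^ 2 + ‖Yt j ((L : ℤ) • boxVec N' z + (L : ℤ) • e κ + boxVec L s) ν‖ ^ 2)) := by
    intro z κ
    have hm72 : 72 * ((2 * d + 2) * L * Real.sqrt (∑ s : Fin d → Fin L, ∑ ν : Fin d,
        (‖Yt j ((L : ℤ) • boxVec N' z + boxVec L s) ν‖ ^ 2 + ‖Yt j ((L : ℤ) • boxVec N' z + (L : ℤ) • e κ + boxVec L s) ν‖ ^ 2))) ≤ 1 :=
      (mul_le_mul_of_nonneg_left (hμ z κ) (by norm_num)).trans hμ72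
    have h := norm_rem2_succ_sub_trueStep_le_twoBlock L hL U₀ U₁ j hV hT (Yt j) (hYt j) (fun _ _ => 0) 0
      (fun z' κ' => by rw [Pi.zero_apply, Pi.zero_apply, trueStep_zero]) (boxVec N' z) κ hm72 (hα z κ) hα24
    simp only [sub_zero, Pi.zero_apply] at h
    rw [hrem, hYt (j + 1)]
    exact h
  -- the F-5a defect as a letter
  obtain ⟨D, hD⟩ : ∃ D : (Fin d → Fin N') → Fin d → 𝔸, ∀ (y : Fin d → Fin N') (μ : Fin d), D y μ
      = fderiv ℂ (eml : ((Fin d → Fin L) → 𝔸) → 𝔸) (fun r => ((Wcx L (avgIter L U₀ j) ((L : ℤ) • boxVec N' y) μ (boxVec L r) : 𝔸ˣ) : 𝔸))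
            (fun r => tsum (avgIter L U₀ j) Xj ((L : ℤ) • boxVec N' y) (gammaWord L μ (boxVec L r) ++ seg μ (-(L : ℤ)))
              * ((Wcx L (avgIter L U₀ j) ((L : ℤ) • boxVec N' y) μ (boxVec L r) : 𝔸ˣ) : 𝔸))
            * (((expUnit (Xavg L (avgIter L U₀ j) ((L : ℤ) • boxVec N' y) μ))⁻¹ : 𝔸ˣ) : 𝔸)
          + ((expUnit (Xavg L (avgIter L U₀ j) ((L : ℤ) • boxVec N' y) μ) : 𝔸ˣ) : 𝔸) * tsum (avgIter L U₀ j) Xj ((L : ℤ) • boxVec N' y) (seg μ (L : ℤ))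
            * (((expUnit (Xavg L (avgIter L U₀ j) ((L : ℤ) • boxVec N' y) μ))⁻¹ : 𝔸ˣ) : 𝔸)
          - (FhatCov L (avgIter L U₀ j) Xj ((L : ℤ) • boxVec N' y)
              - conjR (bavg L (avgIter L U₀ j) ((L : ℤ) • boxVec N' y) μ) (FhatCov L (avgIter L U₀ j) Xj ((L : ℤ) • boxVec N' y + (L : ℤ) • e μ))
              + (L : ℝ) • Q0cov L (avgIter L U₀ j) Xj ((L : ℤ) • boxVec N' y) μ) := ⟨fun y μ => _, fun _ _ => rfl⟩
  -- pointwise: deviation from the straight step = F-5a defect + source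
  have hdec : ∀ (y : Fin d → Fin N') (μ : Fin d), Xj1 (boxVec N' y) μ
        - ∑ r : Fin d → Fin L, ∑ t ∈ Finset.range L, (((L : ℝ) ^ d)⁻¹) •
            conjR (hol (avgIter L U₀ j) ((L : ℤ) • boxVec N' y) (treeWord (boxVec L r) ++ seg μ (t : ℤ))) (Xj ((L : ℤ) • boxVec N' y + boxVec L r + (t : ℤ) • e μ) μ)
      = D y μ + rem (boxVec N' y) μ := by
    intro y μ
    rw [hD, hXs, smul_add, ← smul_Q0cov_eq_sum L hL, avgIter_succ, rescale_apply]
    abel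
  -- the two cell rows by name
  have hF5c := sum_cell_trueStep_defect_sq_le L N' hL (avgIter L U₀ j) hV Xj hX hα hα24
  simp only [← hD] at hF5c
  have hsrc := sum_cell_normSq_source_le L N' hL rem (Yt j) hY (C := 260) (by norm_num) hR hμ
  have hsplit := sum_cell_normSq_add_le (Finset.univ : Finset ((Fin d → Fin N') × Fin d)) (fun p => D p.1 p.2) (fun p => rem (boxVec N' p.1) p.2)
  simp only [Fintype.sum_prod_type] at hsplit
  calc ∑ μ : Fin d, ∑ y : Fin d → Fin N', ‖Xj1 (boxVec N' y) μ
          - ∑ r : Fin d → Fin L, ∑ t ∈ Finset.range L, (((L : ℝ) ^ d)⁻¹) •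
              conjR (hol (avgIter L U₀ j) ((L : ℤ) • boxVec N' y) (treeWord (boxVec L r) ++ seg μ (t : ℤ))) (Xj ((L : ℤ) • boxVec N' y + boxVec L r + (t : ℤ) • e μ) μ)‖ ^ 2
      = ∑ μ : Fin d, ∑ y : Fin d → Fin N', ‖D y μ + rem (boxVec N' y) μ‖ ^ 2 := by simp_rw [hdec]
    _ = ∑ y : Fin d → Fin N', ∑ μ : Fin d, ‖D y μ + rem (boxVec N' y) μ‖ ^ 2 := Finset.sum_comm
    _ ≤ 2 * ∑ y : Fin d → Fin N', ∑ μ : Fin d, ‖D y μ‖ ^ 2 + 2 * ∑ y : Fin d → Fin N', ∑ μ : Fin d, ‖rem (boxVec N' y) μ‖ ^ 2 := hsplit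
    _ ≤ _ := add_le_add (mul_le_mul_of_nonneg_left hF5c (by norm_num)) (mul_le_mul_of_nonneg_left hsrc (by norm_num))

end Summit.QuantumFields.YangMills.Theorems.Prop7CornerCombLinesInhabited

end
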